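import Mathlib
import HarnessLib

/-!
# Green's relations in a monoid: Green's lemma and group `𝓗`-classes

Source: O. Ganyushkin, V. Mazorchuk, *Classical Finite Transformation Semigroups*, Algebra and
Applications 9, Springer (2009) [GanyushkinMazorchuk2009], §4.4 "Green's relations"
(Propositions 4.4.1, 4.4.2, the compatibility remarks after them, Lemma 4.4.4,
Lemma 4.4.7 (Green's lemma) with its dual Lemma 4.4.8, Corollary 4.4.9, Exercise 4.4.10,
Theorem 4.4.11), §4.7 (Proposition 4.7.1, Corollary 4.7.2, 4.7.6) and §5.1 (Theorem 5.1.3).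

The book works in a semigroup `S` and its monoid extension `S¹`; we work directly in a monoid
`M` (so `S¹ = M`), which is the case of the transformation monoids.  Following
Propositions 4.4.1 and 4.4.2 (which characterise the relations defined through principal
one-sided ideals), and introducing no definitions, we read

* `a 𝓛 b` as `(∃ x, a = x * b) ∧ (∃ y, b = y * a)`,
* `a 𝓡 b` as `(∃ x, a = b * x) ∧ (∃ y, b = a * y)`,
* `a 𝓗 b` as `a 𝓛 b ∧ a 𝓡 b`, and `a 𝓓 b` as `∃ c, a 𝓛 c ∧ c 𝓡 b` (`𝓓 = 𝓛 ∘ 𝓡`).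

Main statements:
* `𝓛`, `𝓡` are equivalence relations, `𝓛` is right compatible and `𝓡` is left compatible
  (`greenL_refl`, …, `greenL_mul_right`, `greenR_mul_left`);
* Lemma 4.4.4: `𝓛 ∘ 𝓡 = 𝓡 ∘ 𝓛` (`greenL_comp_greenR_iff`);
* Lemma 4.4.7 (Green) / Lemma 4.4.8: for `a 𝓡 b`, `au = b`, `bv = a`, right translation by `u`
  is a bijection `𝓛(a) → 𝓛(b)` with inverse translation by `v`, preserving `𝓡`-classes, hence
  a bijection `𝓗(a) → 𝓗(b)` (`green_lemma_mapsTo`, `green_lemma_leftInv`, `green_lemma_greenR`,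
  `green_lemma_bijOn_L`, `green_lemma_bijOn_H`; duals `green_lemma_dual_bijOn_R`,
  `green_lemma_dual_bijOn_H`);
* Corollary 4.4.9: all `𝓗`-classes inside one `𝓓`-class are in bijection
  (`exists_bijOn_greenH_of_greenD`);
* Theorem 4.4.11 with 4.7.6 / Theorem 5.1.3 (i): the `𝓗`-class of an idempotent `e` is exactly
  the group of units of the local monoid `eMe` — in particular a group with identity `e`,
  closed under multiplication (`greenH_idempotent_iff`, `mul_greenH_idempotent`);
* Theorem 5.1.3 (ii): the maximal subgroups at distinct idempotents are disjoint
  (`idempotent_eq_of_mem_localUnits`);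
* Proposition 4.7.1 / Corollary 4.7.2: `a` is regular iff `a 𝓡 e` for an idempotent `e` iff
  `a 𝓛 e` for an idempotent `e`; regularity is a property of `𝓓`-classes
  (`regular_iff_exists_idempotent_greenR`, `regular_iff_exists_idempotent_greenL`,
  `regular_of_greenL`, `regular_of_greenR`, `regular_of_greenD`).

Not typed here: Exercise 4.4.10 and the implication (c) ⇒ (a) of Theorem 4.4.11, Theorem 4.7.5.
-/

namespace Literature.Algebra.Semigroups

variable {M : Type*} [Monoid M]

/-! ### `𝓛` and `𝓡` are equivalence relations; compatibility -/

/-- `𝓛` is reflexive. [cite: GanyushkinMazorchuk2009, Proposition 4.4.1] -/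
theorem greenL_refl (a : M) : (∃ x, a = x * a) ∧ ∃ y, a = y * a :=
  ⟨⟨1, (one_mul a).symm⟩, ⟨1, (one_mul a).symm⟩⟩

/-- `𝓛` is symmetric. [cite: GanyushkinMazorchuk2009, Proposition 4.4.1] -/
theorem greenL_symm {a b : M} (h : (∃ x, a = x * b) ∧ ∃ y, b = y * a) :
    (∃ x, b = x * a) ∧ ∃ y, a = y * b :=
  ⟨h.2, h.1⟩

/-- `𝓛` is transitive. [cite: GanyushkinMazorchuk2009, Proposition 4.4.1] -/
theorem greenL_trans {a b c : M} (h₁ : (∃ x, a = x * b) ∧ ∃ y, b = y * a)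
    (h₂ : (∃ x, b = x * c) ∧ ∃ y, c = y * b) : (∃ x, a = x * c) ∧ ∃ y, c = y * a := by
  obtain ⟨⟨x, rfl⟩, ⟨y, hy⟩⟩ := h₁
  obtain ⟨⟨x', rfl⟩, ⟨y', hy'⟩⟩ := h₂
  exact ⟨⟨x * x', by rw [mul_assoc]⟩, ⟨y' * y, by rw [mul_assoc, ← hy, ← hy']⟩⟩

/-- `𝓡` is reflexive. [cite: GanyushkinMazorchuk2009, Proposition 4.4.2] -/
theorem greenR_refl (a : M) : (∃ x, a = a * x) ∧ ∃ y, a = a * y :=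
  ⟨⟨1, (mul_one a).symm⟩, ⟨1, (mul_one a).symm⟩⟩

/-- `𝓡` is symmetric. [cite: GanyushkinMazorchuk2009, Proposition 4.4.2] -/
theorem greenR_symm {a b : M} (h : (∃ x, a = b * x) ∧ ∃ y, b = a * y) :
    (∃ x, b = a * x) ∧ ∃ y, a = b * y :=
  ⟨h.2, h.1⟩

/-- `𝓡` is transitive. [cite: GanyushkinMazorchuk2009, Proposition 4.4.2] -/
theorem greenR_trans {a b c : M} (h₁ : (∃ x, a = b * x) ∧ ∃ y, b = a * y)
    (h₂ : (∃ x, b = c * x) ∧ ∃ y, c = b * y) : (∃ x, a = c * x) ∧ ∃ y, c = a * y := by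
  obtain ⟨⟨x, rfl⟩, ⟨y, hy⟩⟩ := h₁
  obtain ⟨⟨x', rfl⟩, ⟨y', hy'⟩⟩ := h₂
  exact ⟨⟨x' * x, by rw [mul_assoc]⟩, ⟨y * y', by rw [← mul_assoc, ← hy, ← hy']⟩⟩

/-- `𝓛` is right compatible: `a 𝓛 b` implies `az 𝓛 bz` (remark after Proposition 4.4.2).
[cite: GanyushkinMazorchuk2009, Proposition 4.4.1] -/
theorem greenL_mul_right {a b : M} (h : (∃ x, a = x * b) ∧ ∃ y, b = y * a) (z : M) :
    (∃ x, a * z = x * (b * z)) ∧ ∃ y, b * z = y * (a * z) := by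
  obtain ⟨⟨x, hx⟩, ⟨y, hy⟩⟩ := h
  exact ⟨⟨x, by rw [hx, mul_assoc]⟩, ⟨y, by rw [hy, mul_assoc]⟩⟩

/-- `𝓡` is left compatible: `a 𝓡 b` implies `za 𝓡 zb` (remark after Proposition 4.4.2).
[cite: GanyushkinMazorchuk2009, Proposition 4.4.2] -/
theorem greenR_mul_left {a b : M} (h : (∃ x, a = b * x) ∧ ∃ y, b = a * y) (z : M) :
    (∃ x, z * a = z * b * x) ∧ ∃ y, z * b = z * a * y := by
  obtain ⟨⟨x, hx⟩, ⟨y, hy⟩⟩ := h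
  exact ⟨⟨x, by rw [hx, mul_assoc]⟩, ⟨y, by rw [hy, mul_assoc]⟩⟩

/-! ### Lemma 4.4.4: `𝓛 ∘ 𝓡 = 𝓡 ∘ 𝓛` -/

/-- **Lemma 4.4.4**: the relations `𝓛` and `𝓡` commute, `𝓛 ∘ 𝓡 = 𝓡 ∘ 𝓛`: there is `c` with
`a 𝓛 c 𝓡 b` iff there is `d` with `a 𝓡 d 𝓛 b`.  As in the book, if `a = xc` and `b = cy` then
`d = xcy = ay = xb` works (by the compatibilities), and dually.
[cite: GanyushkinMazorchuk2009, Lemma 4.4.4] -/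
theorem greenL_comp_greenR_iff (a b : M) :
    (∃ c, ((∃ x, a = x * c) ∧ ∃ y, c = y * a) ∧ ((∃ x, c = b * x) ∧ ∃ y, b = c * y)) ↔
      ∃ d, ((∃ x, a = d * x) ∧ ∃ y, d = a * y) ∧ ((∃ x, d = x * b) ∧ ∃ y, b = y * d) := by
  constructor
  · rintro ⟨c, hL, hR⟩
    obtain ⟨⟨x, hx⟩, -⟩ := id hL
    obtain ⟨-, ⟨y, hy⟩⟩ := id hR
    have hxb : x * b = a * y := by rw [hy, ← mul_assoc, ← hx]
    refine ⟨a * y, ?_, ?_⟩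
    · have h1 := greenR_mul_left hR x
      rw [← hx, hxb] at h1
      exact h1
    · have h2 := greenL_mul_right hL y
      rw [← hy] at h2
      exact h2
  · rintro ⟨d, hR, hL⟩
    obtain ⟨⟨p, hp⟩, -⟩ := id hR
    obtain ⟨-, ⟨q, hq⟩⟩ := id hL
    have hqa : q * a = b * p := by rw [hp, ← mul_assoc, ← hq]
    refine ⟨b * p, ?_, ?_⟩
    · have h1 := greenL_mul_right hL p
      rw [← hp] at h1
      exact h1
    · have h2 := greenR_mul_left hR q
      rw [← hq, hqa] at h2
      exact h2

/-! ### Lemma 4.4.7: Green's lemma, and its dual Lemma 4.4.8 -/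

/-- **Lemma 4.4.7 (i)** (Green's lemma): if `au = b` then right translation `λᵤ : x ↦ xu` maps
`𝓛(a)` into `𝓛(b)`. [cite: GanyushkinMazorchuk2009, Lemma 4.4.7] -/
theorem green_lemma_mapsTo {a b u : M} (hu : a * u = b) :
    Set.MapsTo (· * u) {x | (∃ p, x = p * a) ∧ ∃ q, a = q * x}
      {y | (∃ p, y = p * b) ∧ ∃ q, b = q * y} := by
  intro x hx
  have := greenL_mul_right hx u
  rw [hu] at this
  exact this

/-- **Lemma 4.4.7 (ii)** (Green's lemma): if `au = b` and `bv = a` then `λᵥλᵤ` is the identity on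
`𝓛(a)`: `xuv = x` for `x = pa`. [cite: GanyushkinMazorchuk2009, Lemma 4.4.7] -/
theorem green_lemma_leftInv {a b u v : M} (hu : a * u = b) (hv : b * v = a) {x : M}
    (hx : (∃ p, x = p * a) ∧ ∃ q, a = q * x) : x * u * v = x := by
  obtain ⟨⟨p, rfl⟩, -⟩ := hx
  rw [mul_assoc p a u, hu, mul_assoc, hv]

/-- **Lemma 4.4.7 (iii)** (Green's lemma): if `au = b`, `bv = a` and `x ∈ 𝓛(a)` then
`xu 𝓡 x`. [cite: GanyushkinMazorchuk2009, Lemma 4.4.7] -/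
theorem green_lemma_greenR {a b u v : M} (hu : a * u = b) (hv : b * v = a) {x : M}
    (hx : (∃ p, x = p * a) ∧ ∃ q, a = q * x) :
    (∃ s, x * u = x * s) ∧ ∃ t, x = x * u * t :=
  ⟨⟨u, rfl⟩, ⟨v, (green_lemma_leftInv hu hv hx).symm⟩⟩

/-- **Lemma 4.4.7 (i)–(ii)** (Green's lemma): if `au = b` and `bv = a` (in particular
`a 𝓡 b`), right translation by `u` is a bijection `𝓛(a) → 𝓛(b)`, with inverse right
translation by `v`. [cite: GanyushkinMazorchuk2009, Lemma 4.4.7] -/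
theorem green_lemma_bijOn_L {a b u v : M} (hu : a * u = b) (hv : b * v = a) :
    Set.BijOn (· * u) {x | (∃ p, x = p * a) ∧ ∃ q, a = q * x}
      {y | (∃ p, y = p * b) ∧ ∃ q, b = q * y} := by
  refine Set.BijOn.mk (green_lemma_mapsTo hu) ?_ ?_
  · intro x hx x' hx' h
    have h' : x * u = x' * u := h
    rw [← green_lemma_leftInv hu hv hx, ← green_lemma_leftInv hu hv hx', h']
  · intro y hy
    exact ⟨y * v, green_lemma_mapsTo hv hy, green_lemma_leftInv hv hu hy⟩

/-- **Green's lemma** for `𝓗`-classes (the remark after Lemma 4.4.7): if `au = b` and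
`bv = a`, right translation by `u` is a bijection `𝓗(a) → 𝓗(b)`.
[cite: GanyushkinMazorchuk2009, Lemma 4.4.7] -/
theorem green_lemma_bijOn_H {a b u v : M} (hu : a * u = b) (hv : b * v = a) :
    Set.BijOn (· * u)
      {x | ((∃ p, x = p * a) ∧ ∃ q, a = q * x) ∧ ((∃ s, x = a * s) ∧ ∃ t, a = x * t)}
      {y | ((∃ p, y = p * b) ∧ ∃ q, b = q * y) ∧ ((∃ s, y = b * s) ∧ ∃ t, b = y * t)} := by
  have hab : (∃ s, a = b * s) ∧ ∃ t, b = a * t := ⟨⟨v, hv.symm⟩, ⟨u, hu.symm⟩⟩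
  have hba : (∃ s, b = a * s) ∧ ∃ t, a = b * t := greenR_symm hab
  have maps : ∀ {a b u v : M}, a * u = b → b * v = a → ((∃ s, a = b * s) ∧ ∃ t, b = a * t) →
      Set.MapsTo (· * u)
        {x | ((∃ p, x = p * a) ∧ ∃ q, a = q * x) ∧ ((∃ s, x = a * s) ∧ ∃ t, a = x * t)}
        {y | ((∃ p, y = p * b) ∧ ∃ q, b = q * y) ∧ ((∃ s, y = b * s) ∧ ∃ t, b = y * t)} := by
    intro a b u v hu hv hab x hx
    refine ⟨green_lemma_mapsTo hu hx.1, ?_⟩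
    -- `xu 𝓡 x 𝓡 a 𝓡 b`
    exact greenR_trans (greenR_trans (green_lemma_greenR hu hv hx.1) hx.2) hab
  refine Set.BijOn.mk (maps hu hv hab) ?_ ?_
  · intro x hx x' hx' h
    exact (green_lemma_bijOn_L hu hv).injOn hx.1 hx'.1 h
  · intro y hy
    exact ⟨y * v, maps hv hu hba hy, green_lemma_leftInv hv hu hy.1⟩

/-- **Lemma 4.4.8** (dual Green's lemma): if `ua = b` and `vb = a` (in particular `a 𝓛 b`),
left translation `μᵤ : x ↦ ux` is a bijection `𝓡(a) → 𝓡(b)` with inverse `μᵥ`.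
[cite: GanyushkinMazorchuk2009, Lemma 4.4.8] -/
theorem green_lemma_dual_bijOn_R {a b u v : M} (hu : u * a = b) (hv : v * b = a) :
    Set.BijOn (u * ·) {x | (∃ s, x = a * s) ∧ ∃ t, a = x * t}
      {y | (∃ s, y = b * s) ∧ ∃ t, b = y * t} := by
  have maps : ∀ {a b u : M}, u * a = b →
      Set.MapsTo (u * ·) {x | (∃ s, x = a * s) ∧ ∃ t, a = x * t}
        {y | (∃ s, y = b * s) ∧ ∃ t, b = y * t} := by
    intro a b u hu x hx
    have := greenR_mul_left hx u
    rw [hu] at this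
    obtain ⟨⟨s, hs⟩, ⟨t, ht⟩⟩ := this
    exact ⟨⟨s, hs⟩, ⟨t, ht⟩⟩
  have linv : ∀ {a b u v : M}, u * a = b → v * b = a →
      ∀ {x : M}, ((∃ s, x = a * s) ∧ ∃ t, a = x * t) → v * (u * x) = x := by
    intro a b u v hu hv x hx
    obtain ⟨⟨s, rfl⟩, -⟩ := hx
    rw [← mul_assoc u a s, hu, ← mul_assoc, hv]
  refine Set.BijOn.mk (maps hu) ?_ ?_
  · intro x hx x' hx' h
    have h' : u * x = u * x' := h
    rw [← linv hu hv hx, ← linv hu hv hx', h']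
  · intro y hy
    exact ⟨v * y, maps hv hy, linv hv hu hy⟩

/-- **Lemma 4.4.8** (dual Green's lemma) for `𝓗`-classes: if `ua = b` and `vb = a`, left
translation by `u` is a bijection `𝓗(a) → 𝓗(b)`. [cite: GanyushkinMazorchuk2009, Lemma 4.4.8] -/
theorem green_lemma_dual_bijOn_H {a b u v : M} (hu : u * a = b) (hv : v * b = a) :
    Set.BijOn (u * ·)
      {x | ((∃ p, x = p * a) ∧ ∃ q, a = q * x) ∧ ((∃ s, x = a * s) ∧ ∃ t, a = x * t)}
      {y | ((∃ p, y = p * b) ∧ ∃ q, b = q * y) ∧ ((∃ s, y = b * s) ∧ ∃ t, b = y * t)} := by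
  have hab : (∃ p, a = p * b) ∧ ∃ q, b = q * a := ⟨⟨v, hv.symm⟩, ⟨u, hu.symm⟩⟩
  have hba : (∃ p, b = p * a) ∧ ∃ q, a = q * b := greenL_symm hab
  have linv : ∀ {a b u v : M}, u * a = b → v * b = a →
      ∀ {x : M}, ((∃ s, x = a * s) ∧ ∃ t, a = x * t) → v * (u * x) = x := by
    intro a b u v hu hv x hx
    obtain ⟨⟨s, rfl⟩, -⟩ := hx
    rw [← mul_assoc u a s, hu, ← mul_assoc, hv]
  have maps : ∀ {a b u v : M}, u * a = b → v * b = a → ((∃ p, a = p * b) ∧ ∃ q, b = q * a) →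
      Set.MapsTo (u * ·)
        {x | ((∃ p, x = p * a) ∧ ∃ q, a = q * x) ∧ ((∃ s, x = a * s) ∧ ∃ t, a = x * t)}
        {y | ((∃ p, y = p * b) ∧ ∃ q, b = q * y) ∧ ((∃ s, y = b * s) ∧ ∃ t, b = y * t)} := by
    intro a b u v hu hv hab x hx
    refine ⟨?_, (green_lemma_dual_bijOn_R hu hv).mapsTo hx.2⟩
    -- `ux 𝓛 x 𝓛 a 𝓛 b`
    have h1 : (∃ p, u * x = p * x) ∧ ∃ q, x = q * (u * x) :=
      ⟨⟨u, rfl⟩, ⟨v, (linv hu hv hx.2).symm⟩⟩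
    exact greenL_trans (greenL_trans h1 hx.1) hab
  refine Set.BijOn.mk (maps hu hv hab) ?_ ?_
  · intro x hx x' hx' h
    exact (green_lemma_dual_bijOn_R hu hv).injOn hx.2 hx'.2 h
  · intro y hy
    exact ⟨v * y, maps hv hu hba hy, linv hv hu hy.2⟩

/-- **Corollary 4.4.9**: all `𝓗`-classes inside the same `𝓓`-class have the same cardinality —
if `a 𝓓 b` (`a 𝓛 c 𝓡 b`) then `x ↦ u'(x)u` (a left translation composed with a right
translation, from the two Green lemmas) is a bijection `𝓗(a) → 𝓗(b)`.
[cite: GanyushkinMazorchuk2009, Corollary 4.4.9] -/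
theorem exists_bijOn_greenH_of_greenD {a b : M}
    (h : ∃ c, ((∃ x, a = x * c) ∧ ∃ y, c = y * a) ∧ ((∃ x, c = b * x) ∧ ∃ y, b = c * y)) :
    ∃ f : M → M, Set.BijOn f
      {x | ((∃ p, x = p * a) ∧ ∃ q, a = q * x) ∧ ((∃ s, x = a * s) ∧ ∃ t, a = x * t)}
      {y | ((∃ p, y = p * b) ∧ ∃ q, b = q * y) ∧ ((∃ s, y = b * s) ∧ ∃ t, b = y * t)} := by
  obtain ⟨c, ⟨⟨x, hx⟩, ⟨y, hy⟩⟩, ⟨⟨x', hx'⟩, ⟨y', hy'⟩⟩⟩ := h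
  -- `ya = c`, `xc = a`: left translation by `y` is a bijection `𝓗(a) → 𝓗(c)`;
  -- `cy' = b`, `bx' = c`: right translation by `y'` is a bijection `𝓗(c) → 𝓗(b)`.
  exact ⟨(· * y') ∘ (y * ·),
    (green_lemma_bijOn_H hy'.symm hx'.symm).comp (green_lemma_dual_bijOn_H hy.symm hx.symm)⟩

/-! ### Theorem 4.4.11, 4.7.6, Theorem 5.1.3: the `𝓗`-class of an idempotent -/

/-- **Theorem 5.1.3 (i)** with **4.7.6** and **Theorem 4.4.11** ((b) ⇒ (a)): for an idempotent
`e`, the `𝓗`-class `𝓗(e)` is exactly the group of units `(eMe)*` of the local submonoid `eMe`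
(Lemma 5.1.1): `x 𝓗 e` iff `ex = x = xe` and `x` has a two-sided inverse `y ∈ eMe` with
`xy = yx = e`.  In particular `𝓗(e)` is the maximal subgroup `G_e` with identity `e`.
[cite: GanyushkinMazorchuk2009, Theorem 5.1.3 (i)] -/
theorem greenH_idempotent_iff {e : M} (he : e * e = e) (x : M) :
    (((∃ p, x = p * e) ∧ ∃ q, e = q * x) ∧ ((∃ s, x = e * s) ∧ ∃ t, e = x * t)) ↔
      e * x = x ∧ x * e = x ∧ ∃ y, (e * y = y ∧ y * e = y) ∧ x * y = e ∧ y * x = e := by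
  constructor
  · rintro ⟨⟨⟨p, hp⟩, ⟨q, hq⟩⟩, ⟨⟨s, hs⟩, ⟨t, ht⟩⟩⟩
    have hxe : x * e = x := by rw [hp, mul_assoc, he]
    have hex : e * x = x := by rw [hs, ← mul_assoc, he]
    -- from `e = qx` and `xt = e`: `et = qxt = qe`
    have het : e * t = q * e := by
      conv_lhs => rw [hq]
      rw [mul_assoc, ← ht]
    refine ⟨hex, hxe, e * t * e, ⟨by rw [← mul_assoc, ← mul_assoc, he], by rw [mul_assoc, he]⟩,
      ?_, ?_⟩
    · calc x * (e * t * e) = (x * e) * t * e := by simp only [mul_assoc]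
        _ = e := by rw [hxe, ← ht, he]
    · calc e * t * e * x = q * e * (e * x) := by rw [het]; simp only [mul_assoc]
        _ = e := by rw [hex, mul_assoc, hex, ← hq]
  · rintro ⟨hex, hxe, y, -, hxy, hyx⟩
    exact ⟨⟨⟨x, hxe.symm⟩, ⟨y, hyx.symm⟩⟩, ⟨⟨x, hex.symm⟩, ⟨y, hxy.symm⟩⟩⟩

/-- **Theorem 4.4.11** ((b) ⇒ (a), closure part): the `𝓗`-class of an idempotent `e` is closed
under multiplication (so, by `greenH_idempotent_iff`, it is a group with identity `e`).
[cite: GanyushkinMazorchuk2009, Theorem 4.4.11] -/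
theorem mul_greenH_idempotent {e : M} (he : e * e = e) {x z : M}
    (hx : ((∃ p, x = p * e) ∧ ∃ q, e = q * x) ∧ ((∃ s, x = e * s) ∧ ∃ t, e = x * t))
    (hz : ((∃ p, z = p * e) ∧ ∃ q, e = q * z) ∧ ((∃ s, z = e * s) ∧ ∃ t, e = z * t)) :
    ((∃ p, x * z = p * e) ∧ ∃ q, e = q * (x * z)) ∧ ((∃ s, x * z = e * s) ∧ ∃ t, e = x * z * t) := by
  rw [greenH_idempotent_iff he] at hx hz ⊢
  obtain ⟨hex, hxe, y, ⟨hey, hye⟩, hxy, hyx⟩ := hx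
  obtain ⟨hez, hze, w, ⟨hew, hwe⟩, hzw, hwz⟩ := hz
  refine ⟨by rw [← mul_assoc, hex], by rw [mul_assoc, hze], w * y,
    ⟨by rw [← mul_assoc, hew], by rw [mul_assoc, hye]⟩, ?_, ?_⟩
  · calc x * z * (w * y) = x * (z * w) * y := by simp only [mul_assoc]
      _ = e := by rw [hzw, hxe, hxy]
  · calc w * y * (x * z) = w * (y * x) * z := by simp only [mul_assoc]
      _ = e := by rw [hyx, hwe, hwz]

/-- **Theorem 4.4.11** ((a) ⇒ (b)): the identity element of a group `𝓗`-class is an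
idempotent — if `e` is a left identity for `x` (`ex = x`) and `x` has a right inverse `y`
relative to `e` (`xy = e`), then `ee = e`. [cite: GanyushkinMazorchuk2009, Theorem 4.4.11] -/
theorem idempotent_of_unit_local {e x y : M} (hex : e * x = x) (hxy : x * y = e) :
    e * e = e := by
  nth_rw 2 [← hxy]
  rw [← mul_assoc, hex, hxy]

/-- **Theorem 5.1.3 (ii)**: maximal subgroups at different idempotents are disjoint — if `a`
lies in the group of units of `eMe` and of `fMf` (identities `e`, `f`; `ab = e`, `ca = f`) then
`e = f`: `e = ab = fab = fe = cae = ca = f`. [cite: GanyushkinMazorchuk2009, Theorem 5.1.3 (ii)] -/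
theorem idempotent_eq_of_mem_localUnits {e f a b c : M} (hab : a * b = e) (hca : c * a = f)
    (hfa : f * a = a) (hae : a * e = a) : e = f := by
  calc e = a * b := hab.symm
    _ = f * a * b := by rw [hfa]
    _ = f * e := by rw [mul_assoc, hab]
    _ = c * a * e := by rw [hca]
    _ = c * a := by rw [mul_assoc, hae]
    _ = f := hca

/-! ### Proposition 4.7.1 and Corollary 4.7.2: regular elements -/

/-- **Proposition 4.7.1** ((a) ⇔ (b)): `a` is regular (`aba = a` for some `b`) iff `a 𝓡 e` for
some idempotent `e` (namely `e = ab`). [cite: GanyushkinMazorchuk2009, Proposition 4.7.1] -/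
theorem regular_iff_exists_idempotent_greenR (a : M) :
    (∃ b, a * b * a = a) ↔ ∃ e, e * e = e ∧ ((∃ x, a = e * x) ∧ ∃ y, e = a * y) := by
  constructor
  · rintro ⟨b, hb⟩
    refine ⟨a * b, ?_, ⟨a, hb.symm⟩, ⟨b, rfl⟩⟩
    rw [← mul_assoc, hb]
  · rintro ⟨e, he, ⟨x, hx⟩, ⟨y, hy⟩⟩
    refine ⟨y, ?_⟩
    rw [← hy, hx, ← mul_assoc, he]

/-- **Proposition 4.7.1** ((a) ⇔ (c)): `a` is regular iff `a 𝓛 e` for some idempotent `e`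
(namely `e = ba`). [cite: GanyushkinMazorchuk2009, Proposition 4.7.1] -/
theorem regular_iff_exists_idempotent_greenL (a : M) :
    (∃ b, a * b * a = a) ↔ ∃ e, e * e = e ∧ ((∃ x, a = x * e) ∧ ∃ y, e = y * a) := by
  constructor
  · rintro ⟨b, hb⟩
    refine ⟨b * a, ?_, ⟨a, by rw [← mul_assoc, hb]⟩, ⟨b, rfl⟩⟩
    rw [mul_assoc, ← mul_assoc a b a, hb]
  · rintro ⟨e, he, ⟨x, hx⟩, ⟨y, hy⟩⟩
    refine ⟨y, ?_⟩
    rw [mul_assoc, ← hy, hx, mul_assoc, he]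

/-- **Corollary 4.7.2** (`𝓛` part): if `a` is regular then so is every `x 𝓛 a`.
[cite: GanyushkinMazorchuk2009, Corollary 4.7.2] -/
theorem regular_of_greenL {a x : M} (ha : ∃ b, a * b * a = a)
    (hx : (∃ p, x = p * a) ∧ ∃ q, a = q * x) : ∃ b, x * b * x = x := by
  obtain ⟨b, hb⟩ := ha
  obtain ⟨⟨p, hp⟩, ⟨q, hq⟩⟩ := hx
  refine ⟨b * q, ?_⟩
  calc x * (b * q) * x = p * (a * b * (q * x)) := by rw [hp]; simp only [mul_assoc]
    _ = x := by rw [← hq, hb, hp]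

/-- **Corollary 4.7.2** (`𝓡` part): if `a` is regular then so is every `x 𝓡 a`.
[cite: GanyushkinMazorchuk2009, Corollary 4.7.2] -/
theorem regular_of_greenR {a x : M} (ha : ∃ b, a * b * a = a)
    (hx : (∃ s, x = a * s) ∧ ∃ t, a = x * t) : ∃ b, x * b * x = x := by
  obtain ⟨b, hb⟩ := ha
  obtain ⟨⟨s, hs⟩, ⟨t, ht⟩⟩ := hx
  refine ⟨t * b, ?_⟩
  calc x * (t * b) * x = (x * t) * b * a * s := by rw [hs]; simp only [mul_assoc]
    _ = x := by rw [← ht, hb, hs]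

/-- **Corollary 4.7.2**: if `a` is regular then every element of `𝓓(a)` is regular (for
`a 𝓓 x`, i.e. `a 𝓛 c 𝓡 x`). [cite: GanyushkinMazorchuk2009, Corollary 4.7.2] -/
theorem regular_of_greenD {a x : M} (ha : ∃ b, a * b * a = a)
    (hx : ∃ c, ((∃ p, a = p * c) ∧ ∃ q, c = q * a) ∧ ((∃ s, c = x * s) ∧ ∃ t, x = c * t)) :
    ∃ b, x * b * x = x := by
  obtain ⟨c, hL, hR⟩ := hx
  exact regular_of_greenR (regular_of_greenL ha (greenL_symm hL)) (greenR_symm hR)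

end Literature.Algebra.Semigroups
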